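import Summits.BirchSwinnertonDyer.BirchSwinnertonDyer.Theorems.ManinLocalTwoThreeKummerWitnessExtensionB
import Summits.BirchSwinnertonDyer.BirchSwinnertonDyer.Theorems.ManinLocalTwoThreeKummerWitnessInvarianceB
import Summits.BirchSwinnertonDyer.BirchSwinnertonDyer.Theorems.ManinLocalTwoThreeKummerSquareRootSigmaDictionary
import HarnessLib

/-!
# The ℓ = 2 witness line, pieces (HOLB₂) and (INVB₂): the B-witness `C₀·B_d·(t_W∘φ)·V_{a,e}(c·E_f)` built on the `σ`-SQUARE ROOT extends
# holomorphically to `ℍ`, is bounded at every cusp, and its `Γ₀(N)`-stabiliser is EXACTLY the period group `Γ_V`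
(route `ManinLocalTwoThree`, deciding crux C2 `ManinOddAtFour` stmt-BirchSwinnertonDyer-22967; cell bsd-f2-manin, prover p2 gen 19; LEAD-MEMO v35 §3–§4
«the ℓ = 2 UDC chain», toward the witness law AN2₂ of p2's `…UDCGlueTwo`; `--supports stmt-BirchSwinnertonDyer-22967`)

KEY REMARK (`sigmaSqRoot_eq_sigmaCubeRoot`).  The `σ`-square root `V_{a,e}(w) = e^{ew/2}σ(w−a)/σ(w)` (p2 g16) IS the tree's `σ`-cube-root expression
`W_{a,3e/2}(w) = e^{(3e/2)w/3}σ(w−a)/σ(w)` — so the ℓ = 2 block `(t_W∘φ)·V_{a,e}(c·E_f)` is `kummerMinBlock D a (3e/2)` and every (u,e)-GENERIC theorem of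
the ℓ = 3 B-line applies verbatim.  The landed (HOLB) `kummerMinimalWitnessExtensionB_holds` (p2 g17) carries the binder `3u = m₁ω₁ + m₂ω₂`, which its
proof never uses; §1 re-runs that proof for ARBITRARY `(u, e)`:
* §1 **`kummerMinimalWitnessExtensionB_general`** — for any `u e : ℂ`, Γ₀(N)-forms `B_n, B_d` of weight `12m` with `B_d·(t_W∘φ) = B_n` on the good set and
  any `C₀`: a holomorphic `F : ℍ → ℂ` equal to `C₀·B_d·kummerMinBlock D u e` on the good set with `F ∣[12m] g` BOUNDED at `i∞` for every `g ∈ SL₂(ℤ)`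
  (two charts: `C₀·B_n·W_{u,e}(w)` on `{σ(w) ≠ 0}`, `C₀·B_d·Φ(w)` on `{Q(w) ≠ 0}`, `Q ≠ 0` on `Λ`; cusp values through `E_f(gτ) = C_g + o(1)`; VERBATIM
  the landed proof);
* §2 **(HOLB₂) `sqRootWitnessExtensionB`** — the same for the square-root block `(t_W∘φ)(τ)·V_{a,e}(c·E_f τ)`;
* §3 **(INVB₂) `sqRootWitnessInvarianceB`** — for `a ∉ Λ`, any `e`, `B_d ≠ 0`, `C₀ ≠ 0` and a holomorphic `F` equal to `C₀·B_d·(t_W∘φ)·V_{a,e}(c·E_f)` on the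
  good set, and `γ ∈ Γ₀(N)`: **`F ∣[12m] γ = F ⟺ V_{a,e}` is periodic under `μ_γ = c·{∞,γ∞}_f`** (p2 g17's generic `WitnessInvariance.slashB_eq_smul`,
  `exists_apply_ne_zero_B`; the multiplier of `V` along `μ_γ ∈ Λ` from `sigmaSqRoot_add_of_mem_lattice`).
HONEST FRAMING.  Two of the four ℓ = 2 witness pieces ((DICT₂), (INT₂) remain; (RATB), (QEXNB), (QXP) are the landed T-free theorems); the witness law AN2₂,
CDT, C2, Manin's conjecture and BSD are NOT proved here.  No definitions, no sorry.
[folklore] [cite: WhittakerWatson1927, §20.421 (quasi-periodicity of σ)] [cite: DiamondShurman2005, §1.2 (slash action; boundedness at the cusps)]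
-/

set_option autoImplicit false
-- lint-debt: the directory name repeats the summit name (sibling precedent `ManinLocalTwoThreeKummerWitnessExtensionB.lean`)
set_option linter.dupNamespace false

noncomputable section

open scoped Topology PeriodPair MatrixGroups Manifold ModularForm
open Complex Filter CongruenceSubgroup
open UpperHalfPlane hiding I
open Literature.NumberTheory.EllipticCurves Literature.NumberTheory.EllipticCurves.ModularForms
open Summit.BirchSwinnertonDyer.Rank1Residual.ManinAdditive.KummerCubeMonodromy
open Summit.BirchSwinnertonDyer.Rank1Residual.ManinAdditive.UDCKummerLine
open Summit.BirchSwinnertonDyer.Rank1Residual.ManinAdditive.UDCKummerWitnessLine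
open Summit.BirchSwinnertonDyer.BirchSwinnertonDyer.Theorems.ManinLocalTwoThree.KummerCubeRootDictionary
open Summit.BirchSwinnertonDyer.BirchSwinnertonDyer.Theorems.ManinLocalTwoThree.KummerCubeSigmaLeaves
open Summit.BirchSwinnertonDyer.BirchSwinnertonDyer.Theorems.ManinLocalTwoThree.SigmaSquareRoot
open Summit.BirchSwinnertonDyer.BirchSwinnertonDyer.Theorems.ManinLocalTwoThree.WitnessInvariance

namespace Summit.BirchSwinnertonDyer.BirchSwinnertonDyer.Theorems.ManinLocalTwoThree.SqRootWitness

variable {W : WeierstrassCurve ℚ} {N : ℕ} [NeZero N]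

/-! ### §0 The square root is the cube-root expression with parameter `3e/2` -/

/-- `V_{a,e} = W_{a,3e/2}` pointwise (`e^{(3e/2)·w/3} = e^{e·w/2}`). [folklore] -/
theorem sigmaSqRoot_eq_sigmaCubeRoot (L : PeriodPair) (a e w : ℂ) : sigmaSqRoot L a e w = sigmaCubeRoot L a (3 * e / 2) w := by
  unfold sigmaSqRoot sigmaCubeRoot
  congr 3
  ring

/-- The ℓ = 2 block is the tree's minimal block with parameter `3e/2`. [folklore] -/
theorem minimalParam_mul_sigmaSqRoot_eq (D : ModularParametrizationData W N) (a e : ℂ) (τ : ℍ) :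
    minimalParam D τ * sigmaSqRoot D.L a e ((D.c : ℂ) * eichlerIntegral D.f τ) = kummerMinBlock D a (3 * e / 2) τ := by
  rw [kummerMinBlock, sigmaSqRoot_eq_sigmaCubeRoot]

/-! ### §1 (HOLB) for arbitrary `(u, e)` — the landed proof, binder `3u ∈ Λ` dropped -/

/-- **(HOLB), generic parameters.**  For ANY `u e : ℂ`: given Γ₀(N)-forms `B_n, B_d` of weight `12m` with `B_d·(t_W∘φ) = B_n` on the good set and a
constant `C₀`, there is a holomorphic `F : ℍ → ℂ` equal to `C₀·B_d·kummerMinBlock D u e` on the good set with `F ∣[12m] g` bounded at `i∞` for every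
`g ∈ SL₂(ℤ)` (growth clause with exponent `0`).  Proof VERBATIM p2 g17's `kummerMinimalWitnessExtensionB_holds`. [folklore] -/
theorem kummerMinimalWitnessExtensionB_general (D : ModularParametrizationData W N) [W.IsElliptic] [W.IsGloballyMinimal] (u e : ℂ)
    (m : ℕ) (Bn Bd : ModularForm (Gamma0 N) (12 * (m : ℤ)))
    (hpres : ∀ τ : ℍ, (D.c : ℂ) * eichlerIntegral D.f τ ∉ D.L.lattice → minimalY D τ ≠ 0 → Bd τ * minimalParam D τ = Bn τ) (C₀ : ℂ) :
    ∃ F : ℍ → ℂ, MDifferentiable 𝓘(ℂ) 𝓘(ℂ) F ∧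
      (∀ τ : ℍ, (D.c : ℂ) * eichlerIntegral D.f τ ∉ D.L.lattice → minimalY D τ ≠ 0 →
        F τ = C₀ * Bd τ * kummerMinBlock D u e τ) ∧
      (∀ g : SL(2, ℤ), ∃ C A m' : ℝ, ∀ τ : ℍ, A ≤ τ.im → ‖(F ∣[(12 * (m : ℤ))] g) τ‖ ≤ C * Real.exp (m' * τ.im)) := by
  classical
  have hc0 : D.c ≠ 0 := D.maninConstant_ne_zero_holds
  have hf : D.f ≠ 0 := newform_ne_zero D
  have hc : (D.c : ℂ) ≠ 0 := Int.cast_ne_zero.mpr hc0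
  obtain ⟨Q, Φ, hQd, hQΛ, hΦd, hY, hblock⟩ := exists_minimal_package' D hc0 u e
  have hσd : Differentiable ℂ D.L.weierstrassSigma := D.L.differentiable_weierstrassSigma_holds
  have hσne : ∀ w, w ∉ D.L.lattice → D.L.weierstrassSigma w ≠ 0 := fun w hw h =>
    hw ((D.L.weierstrassSigma_eq_zero_iff_holds w).mp h)
  have hX : Differentiable ℂ (fun w => cexp (e * w / 3) * D.L.weierstrassSigma (w - u)) :=
    (((differentiable_const _).mul differentiable_id).div_const _).cexp.mul (hσd.comp (differentiable_id.sub_const u))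
  -- good ⟸ `w ∉ Λ ∧ Q(w) ≠ 0`
  have hgood : ∀ τ : ℍ, (D.c : ℂ) * eichlerIntegral D.f τ ∉ D.L.lattice → Q ((D.c : ℂ) * eichlerIntegral D.f τ) ≠ 0 →
      minimalY D τ ≠ 0 := by
    intro τ hw hQ
    rw [hY τ hw]
    exact div_ne_zero (mul_ne_zero (div_ne_zero (pow_ne_zero 3 hc) two_ne_zero) hQ) (pow_ne_zero 3 (hσne _ hw))
  -- the chart-1 value equals `C₀·B_d·block` on the good set, and the chart-2 value where `Q ≠ 0`
  have hval1 : ∀ τ : ℍ, (D.c : ℂ) * eichlerIntegral D.f τ ∉ D.L.lattice → minimalY D τ ≠ 0 →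
      C₀ * Bn τ * sigmaCubeRoot D.L u e ((D.c : ℂ) * eichlerIntegral D.f τ) = C₀ * Bd τ * kummerMinBlock D u e τ := by
    intro τ hw hYne
    rw [← hpres τ hw hYne, kummerMinBlock]
    ring
  have hval2 : ∀ τ : ℍ, (D.c : ℂ) * eichlerIntegral D.f τ ∉ D.L.lattice → Q ((D.c : ℂ) * eichlerIntegral D.f τ) ≠ 0 →
      C₀ * Bn τ * sigmaCubeRoot D.L u e ((D.c : ℂ) * eichlerIntegral D.f τ) = C₀ * Bd τ * Φ ((D.c : ℂ) * eichlerIntegral D.f τ) := by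
    intro τ hw hQ
    rw [hval1 τ hw (hgood τ hw hQ), hblock τ hw hQ]
  refine ⟨fun τ => if (D.c : ℂ) * eichlerIntegral D.f τ ∈ D.L.lattice then C₀ * Bd τ * Φ ((D.c : ℂ) * eichlerIntegral D.f τ)
      else C₀ * Bn τ * sigmaCubeRoot D.L u e ((D.c : ℂ) * eichlerIntegral D.f τ), ?_, ?_, ?_⟩
  · -- holomorphy, in the complex coordinate
    intro τ₀
    rw [UpperHalfPlane.mdifferentiableAt_iff]
    have hEd : DifferentiableAt ℂ (fun z : ℂ => (D.c : ℂ) * eichlerIntegral D.f (ofComplex z)) (τ₀ : ℂ) :=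
      (differentiableAt_const _).mul (hasDerivAt_eichlerIntegral D.f τ₀.im_pos).differentiableAt
    have hBnd : DifferentiableAt ℂ (⇑Bn ∘ ofComplex) (τ₀ : ℂ) := UpperHalfPlane.mdifferentiableAt_iff.mp (ModularFormClass.holo Bn τ₀)
    have hBdd : DifferentiableAt ℂ (⇑Bd ∘ ofComplex) (τ₀ : ℂ) := UpperHalfPlane.mdifferentiableAt_iff.mp (ModularFormClass.holo Bd τ₀)
    have hw0 : (D.c : ℂ) * eichlerIntegral D.f (ofComplex (τ₀ : ℂ)) = (D.c : ℂ) * eichlerIntegral D.f τ₀ := by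
      rw [ofComplex_apply]
    by_cases hΛ0 : (D.c : ℂ) * eichlerIntegral D.f τ₀ ∈ D.L.lattice
    · -- chart 2
      have hQ0 : Q ((D.c : ℂ) * eichlerIntegral D.f (ofComplex (τ₀ : ℂ))) ≠ 0 := by rw [hw0]; exact hQΛ _ hΛ0
      have hev1 : ∀ᶠ z in 𝓝 (τ₀ : ℂ), Q ((D.c : ℂ) * eichlerIntegral D.f (ofComplex z)) ≠ 0 :=
        ((hQd.continuous.continuousAt).comp_of_eq hEd.continuousAt rfl).eventually_ne hQ0
      have hFeq : ((fun τ => if (D.c : ℂ) * eichlerIntegral D.f τ ∈ D.L.lattice then C₀ * Bd τ * Φ ((D.c : ℂ) * eichlerIntegral D.f τ)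
            else C₀ * Bn τ * sigmaCubeRoot D.L u e ((D.c : ℂ) * eichlerIntegral D.f τ)) ∘ ofComplex) =ᶠ[𝓝 (τ₀ : ℂ)]
          fun z => C₀ * (⇑Bd ∘ ofComplex) z * Φ ((D.c : ℂ) * eichlerIntegral D.f (ofComplex z)) := by
        filter_upwards [hev1] with z h1
        simp only [Function.comp_apply]
        by_cases hz : (D.c : ℂ) * eichlerIntegral D.f (ofComplex z) ∈ D.L.lattice
        · rw [if_pos hz]
        · rw [if_neg hz, hval2 (ofComplex z) hz h1]
      have hg : DifferentiableAt ℂ (fun z => C₀ * (⇑Bd ∘ ofComplex) z * Φ ((D.c : ℂ) * eichlerIntegral D.f (ofComplex z))) (τ₀ : ℂ) :=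
        ((differentiableAt_const _).mul hBdd).mul ((hΦd _ hQ0).comp (τ₀ : ℂ) hEd)
      exact hFeq.differentiableAt_iff.mpr hg
    · -- chart 1
      have hopen : IsOpen ((D.L.lattice : Set ℂ)ᶜ) := D.L.isClosed_lattice.isOpen_compl
      have hmem : (D.c : ℂ) * eichlerIntegral D.f (ofComplex (τ₀ : ℂ)) ∈ ((D.L.lattice : Set ℂ)ᶜ) := by
        rw [hw0]; exact hΛ0
      have hev : ∀ᶠ z in 𝓝 (τ₀ : ℂ), (D.c : ℂ) * eichlerIntegral D.f (ofComplex z) ∉ D.L.lattice :=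
        hEd.continuousAt.preimage_mem_nhds (hopen.mem_nhds hmem)
      have hFeq : ((fun τ => if (D.c : ℂ) * eichlerIntegral D.f τ ∈ D.L.lattice then C₀ * Bd τ * Φ ((D.c : ℂ) * eichlerIntegral D.f τ)
            else C₀ * Bn τ * sigmaCubeRoot D.L u e ((D.c : ℂ) * eichlerIntegral D.f τ)) ∘ ofComplex) =ᶠ[𝓝 (τ₀ : ℂ)]
          fun z => C₀ * (⇑Bn ∘ ofComplex) z * (cexp (e * ((D.c : ℂ) * eichlerIntegral D.f (ofComplex z)) / 3) *
            D.L.weierstrassSigma ((D.c : ℂ) * eichlerIntegral D.f (ofComplex z) - u) /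
            D.L.weierstrassSigma ((D.c : ℂ) * eichlerIntegral D.f (ofComplex z))) := by
        filter_upwards [hev] with z hz
        simp only [Function.comp_apply]
        rw [if_neg hz, sigmaCubeRoot]
      have hσ0 : D.L.weierstrassSigma ((D.c : ℂ) * eichlerIntegral D.f (ofComplex (τ₀ : ℂ))) ≠ 0 := by
        rw [hw0]; exact hσne _ hΛ0
      have hXz : DifferentiableAt ℂ (fun z : ℂ => cexp (e * ((D.c : ℂ) * eichlerIntegral D.f (ofComplex z)) / 3) *
          D.L.weierstrassSigma ((D.c : ℂ) * eichlerIntegral D.f (ofComplex z) - u)) (τ₀ : ℂ) :=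
        (hX _).comp (τ₀ : ℂ) hEd
      have hσz : DifferentiableAt ℂ (fun z : ℂ => D.L.weierstrassSigma ((D.c : ℂ) * eichlerIntegral D.f (ofComplex z))) (τ₀ : ℂ) :=
        (hσd _).comp (τ₀ : ℂ) hEd
      have hg : DifferentiableAt ℂ (fun z => C₀ * (⇑Bn ∘ ofComplex) z *
          (cexp (e * ((D.c : ℂ) * eichlerIntegral D.f (ofComplex z)) / 3) *
            D.L.weierstrassSigma ((D.c : ℂ) * eichlerIntegral D.f (ofComplex z) - u) /
            D.L.weierstrassSigma ((D.c : ℂ) * eichlerIntegral D.f (ofComplex z)))) (τ₀ : ℂ) :=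
        ((differentiableAt_const _).mul hBnd).mul (hXz.div hσz hσ0)
      exact hFeq.differentiableAt_iff.mpr hg
  · -- the formula on the good set
    intro τ hw hYne
    simp only [if_neg hw]
    exact hval1 τ hw hYne
  · -- boundedness at every cusp
    intro g
    obtain ⟨Cg, hCg⟩ := exists_eichlerIntegral_smul_eq D.f g
    have hφ := isCuspFunction_slash (k := 2) D.f g
    obtain ⟨T₁, hT₁⟩ :=
      exists_forall_eichlerIntegral_smul_notMem D.f hf (D.L.mulLeft ((D.c : ℂ)⁻¹) (inv_ne_zero hc)) g
    have hT₁' : ∀ τ : ℍ, T₁ ≤ τ.im → (D.c : ℂ) * eichlerIntegral D.f (g • τ) ∉ D.L.lattice := by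
      intro τ hτ h
      apply hT₁ τ hτ
      rw [PeriodPair.mem_mulLeft_lattice, inv_inv]
      exact h
    obtain ⟨MBn, ABn, hMBn⟩ := UpperHalfPlane.isBoundedAtImInfty_iff.mp (ModularFormClass.bdd_at_infty_slash Bn g)
    obtain ⟨MBd, ABd, hMBd⟩ := UpperHalfPlane.isBoundedAtImInfty_iff.mp (ModularFormClass.bdd_at_infty_slash Bd g)
    have hcpos : 0 < ‖(D.c : ℂ)‖ + 1 := by positivity
    have happroach : ∀ δ : ℝ, 0 < δ → ∃ M : ℝ, ∀ τ : ℍ, M ≤ τ.im →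
        dist ((D.c : ℂ) * eichlerIntegral D.f (g • τ)) ((D.c : ℂ) * Cg) < δ := by
      intro δ hδ
      obtain ⟨M, hM⟩ := hφ.exists_forall_norm_verticalIntegral_le (ε := δ / (‖(D.c : ℂ)‖ + 1)) (by positivity)
      refine ⟨M, fun τ hτ => ?_⟩
      rw [dist_eq_norm, hCg τ, mul_add, add_sub_cancel_left, norm_mul]
      calc ‖(D.c : ℂ)‖ * ‖verticalIntegral (⇑D.f ∣[(2 : ℤ)] g) τ‖
          ≤ ‖(D.c : ℂ)‖ * (δ / (‖(D.c : ℂ)‖ + 1)) := mul_le_mul_of_nonneg_left (hM τ hτ) (norm_nonneg _)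
        _ < δ := by
            rw [mul_div_assoc', div_lt_iff₀ hcpos]
            nlinarith [norm_nonneg (D.c : ℂ)]
    by_cases hΛ : (D.c : ℂ) * Cg ∈ D.L.lattice
    · -- the cusp maps to `O`: chart 2
      have hQ0 : Q ((D.c : ℂ) * Cg) ≠ 0 := hQΛ _ hΛ
      obtain ⟨δ₁, hδ₁, hΦball⟩ := Metric.continuousAt_iff.mp (hΦd _ hQ0).continuousAt 1 one_pos
      obtain ⟨δ₂, hδ₂, hQball⟩ := Metric.eventually_nhds_iff.mp ((hQd _).continuousAt.eventually_ne hQ0)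
      obtain ⟨M₃, hM₃⟩ := happroach (min δ₁ δ₂) (lt_min hδ₁ hδ₂)
      refine ⟨‖C₀‖ * MBd * (‖Φ ((D.c : ℂ) * Cg)‖ + 1), max T₁ (max ABd M₃), 0, fun τ hτ => ?_⟩
      have h1 : T₁ ≤ τ.im := (le_max_left _ _).trans hτ
      have hA : ABd ≤ τ.im := (le_max_left _ _).trans ((le_max_right _ _).trans hτ)
      have h3 : M₃ ≤ τ.im := (le_max_right _ _).trans ((le_max_right _ _).trans hτ)
      have hdist := hM₃ τ h3
      have hnotin := hT₁' τ h1
      have hQw : Q ((D.c : ℂ) * eichlerIntegral D.f (g • τ)) ≠ 0 := hQball (lt_of_lt_of_le hdist (min_le_right _ _))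
      have hFval : (if (D.c : ℂ) * eichlerIntegral D.f (g • τ) ∈ D.L.lattice then
            C₀ * Bd (g • τ) * Φ ((D.c : ℂ) * eichlerIntegral D.f (g • τ))
          else C₀ * Bn (g • τ) * sigmaCubeRoot D.L u e ((D.c : ℂ) * eichlerIntegral D.f (g • τ))) =
          C₀ * Bd (g • τ) * Φ ((D.c : ℂ) * eichlerIntegral D.f (g • τ)) := by
        rw [if_neg hnotin, hval2 _ hnotin hQw]
      have hΦbd : ‖Φ ((D.c : ℂ) * eichlerIntegral D.f (g • τ))‖ ≤ ‖Φ ((D.c : ℂ) * Cg)‖ + 1 :=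
        norm_le_norm_add_one_of_dist_lt (hΦball (lt_of_lt_of_le hdist (min_le_left _ _)))
      have hBg := hMBd τ hA
      rw [ModularForm.SL_slash_apply] at hBg
      rw [Real.exp_eq_one_iff _ |>.mpr (by ring), mul_one, ModularForm.SL_slash_apply, hFval,
        show C₀ * Bd (g • τ) * Φ ((D.c : ℂ) * eichlerIntegral D.f (g • τ)) * denom (↑g) τ ^ (-(12 * (m : ℤ))) =
          C₀ * ((Bd (g • τ) * denom (↑g) τ ^ (-(12 * (m : ℤ)))) * Φ ((D.c : ℂ) * eichlerIntegral D.f (g • τ))) by ring,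
        norm_mul, norm_mul]
      have hC : 0 ≤ ‖C₀‖ := norm_nonneg _
      have hMBd0 : 0 ≤ MBd := (norm_nonneg _).trans hBg
      calc ‖C₀‖ * (‖Bd (g • τ) * denom (↑g) τ ^ (-(12 * (m : ℤ)))‖ * ‖Φ ((D.c : ℂ) * eichlerIntegral D.f (g • τ))‖)
          ≤ ‖C₀‖ * (MBd * (‖Φ ((D.c : ℂ) * Cg)‖ + 1)) :=
            mul_le_mul_of_nonneg_left (mul_le_mul hBg hΦbd (norm_nonneg _) hMBd0) hC
        _ = ‖C₀‖ * MBd * (‖Φ ((D.c : ℂ) * Cg)‖ + 1) := by ring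
    · -- the cusp maps to a point `≠ O`: chart 1
      have hσ0 : D.L.weierstrassSigma ((D.c : ℂ) * Cg) ≠ 0 := hσne _ hΛ
      have hVc : ContinuousAt (fun w => cexp (e * w / 3) * D.L.weierstrassSigma (w - u) / D.L.weierstrassSigma w) ((D.c : ℂ) * Cg) :=
        ((hX _).div (hσd _) hσ0).continuousAt
      obtain ⟨δ₁, hδ₁, hVball⟩ := Metric.continuousAt_iff.mp hVc 1 one_pos
      obtain ⟨M₃, hM₃⟩ := happroach δ₁ hδ₁
      refine ⟨‖C₀‖ * MBn * (‖cexp (e * ((D.c : ℂ) * Cg) / 3) * D.L.weierstrassSigma ((D.c : ℂ) * Cg - u) /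
          D.L.weierstrassSigma ((D.c : ℂ) * Cg)‖ + 1), max T₁ (max ABn M₃), 0, fun τ hτ => ?_⟩
      have h1 : T₁ ≤ τ.im := (le_max_left _ _).trans hτ
      have hA : ABn ≤ τ.im := (le_max_left _ _).trans ((le_max_right _ _).trans hτ)
      have h3 : M₃ ≤ τ.im := (le_max_right _ _).trans ((le_max_right _ _).trans hτ)
      have hdist := hM₃ τ h3
      have hnotin := hT₁' τ h1
      have hFval : (if (D.c : ℂ) * eichlerIntegral D.f (g • τ) ∈ D.L.lattice then
            C₀ * Bd (g • τ) * Φ ((D.c : ℂ) * eichlerIntegral D.f (g • τ))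
          else C₀ * Bn (g • τ) * sigmaCubeRoot D.L u e ((D.c : ℂ) * eichlerIntegral D.f (g • τ))) =
          C₀ * Bn (g • τ) * (cexp (e * ((D.c : ℂ) * eichlerIntegral D.f (g • τ)) / 3) *
            D.L.weierstrassSigma ((D.c : ℂ) * eichlerIntegral D.f (g • τ) - u) /
            D.L.weierstrassSigma ((D.c : ℂ) * eichlerIntegral D.f (g • τ))) := by
        rw [if_neg hnotin, sigmaCubeRoot]
      have hVbd : ‖cexp (e * ((D.c : ℂ) * eichlerIntegral D.f (g • τ)) / 3) *
            D.L.weierstrassSigma ((D.c : ℂ) * eichlerIntegral D.f (g • τ) - u) /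
            D.L.weierstrassSigma ((D.c : ℂ) * eichlerIntegral D.f (g • τ))‖ ≤
          ‖cexp (e * ((D.c : ℂ) * Cg) / 3) * D.L.weierstrassSigma ((D.c : ℂ) * Cg - u) / D.L.weierstrassSigma ((D.c : ℂ) * Cg)‖ + 1 :=
        norm_le_norm_add_one_of_dist_lt (hVball hdist)
      have hBg := hMBn τ hA
      rw [ModularForm.SL_slash_apply] at hBg
      rw [Real.exp_eq_one_iff _ |>.mpr (by ring), mul_one, ModularForm.SL_slash_apply, hFval,
        show C₀ * Bn (g • τ) * (cexp (e * ((D.c : ℂ) * eichlerIntegral D.f (g • τ)) / 3) *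
            D.L.weierstrassSigma ((D.c : ℂ) * eichlerIntegral D.f (g • τ) - u) /
            D.L.weierstrassSigma ((D.c : ℂ) * eichlerIntegral D.f (g • τ))) * denom (↑g) τ ^ (-(12 * (m : ℤ))) =
          C₀ * ((Bn (g • τ) * denom (↑g) τ ^ (-(12 * (m : ℤ)))) *
            (cexp (e * ((D.c : ℂ) * eichlerIntegral D.f (g • τ)) / 3) *
              D.L.weierstrassSigma ((D.c : ℂ) * eichlerIntegral D.f (g • τ) - u) /
              D.L.weierstrassSigma ((D.c : ℂ) * eichlerIntegral D.f (g • τ)))) by ring,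
        norm_mul, norm_mul]
      have hC : 0 ≤ ‖C₀‖ := norm_nonneg _
      have hMBn0 : 0 ≤ MBn := (norm_nonneg _).trans hBg
      calc ‖C₀‖ * (‖Bn (g • τ) * denom (↑g) τ ^ (-(12 * (m : ℤ)))‖ *
            ‖cexp (e * ((D.c : ℂ) * eichlerIntegral D.f (g • τ)) / 3) *
              D.L.weierstrassSigma ((D.c : ℂ) * eichlerIntegral D.f (g • τ) - u) /
              D.L.weierstrassSigma ((D.c : ℂ) * eichlerIntegral D.f (g • τ))‖)
          ≤ ‖C₀‖ * (MBn * (‖cexp (e * ((D.c : ℂ) * Cg) / 3) * D.L.weierstrassSigma ((D.c : ℂ) * Cg - u) /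
              D.L.weierstrassSigma ((D.c : ℂ) * Cg)‖ + 1)) :=
            mul_le_mul_of_nonneg_left (mul_le_mul hBg hVbd (norm_nonneg _) hMBn0) hC
        _ = _ := by ring


/-! ### §2 (HOLB₂): the square-root B-witness extends holomorphically and is bounded at the cusps -/

/-- **(HOLB₂).**  For any half-period data `(a, e)` (indeed any `a e : ℂ`), Γ₀(N)-forms `B_n, B_d` of weight `12m` with `B_d·(t_W∘φ) = B_n` on the good
set, and `C₀`: a holomorphic `F` on `ℍ` equal to `C₀·B_d·(t_W∘φ)·V_{a,e}(c·E_f)` on the good set, bounded at every cusp. [folklore] -/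
theorem sqRootWitnessExtensionB (D : ModularParametrizationData W N) [W.IsElliptic] [W.IsGloballyMinimal] (a e : ℂ)
    (m : ℕ) (Bn Bd : ModularForm (Gamma0 N) (12 * (m : ℤ)))
    (hpres : ∀ τ : ℍ, (D.c : ℂ) * eichlerIntegral D.f τ ∉ D.L.lattice → minimalY D τ ≠ 0 → Bd τ * minimalParam D τ = Bn τ) (C₀ : ℂ) :
    ∃ F : ℍ → ℂ, MDifferentiable 𝓘(ℂ) 𝓘(ℂ) F ∧
      (∀ τ : ℍ, (D.c : ℂ) * eichlerIntegral D.f τ ∉ D.L.lattice → minimalY D τ ≠ 0 →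
        F τ = C₀ * Bd τ * (minimalParam D τ * sigmaSqRoot D.L a e ((D.c : ℂ) * eichlerIntegral D.f τ))) ∧
      (∀ g : SL(2, ℤ), ∃ C A m' : ℝ, ∀ τ : ℍ, A ≤ τ.im → ‖(F ∣[(12 * (m : ℤ))] g) τ‖ ≤ C * Real.exp (m' * τ.im)) := by
  obtain ⟨F, hFd, hFeq, hFgr⟩ := kummerMinimalWitnessExtensionB_general D a (3 * e / 2) m Bn Bd hpres C₀
  exact ⟨F, hFd, fun τ hw hY ↦ by rw [minimalParam_mul_sigmaSqRoot_eq]; exact hFeq τ hw hY, hFgr⟩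

/-! ### §3 (INVB₂): the stabiliser of the square-root B-witness is the period group of `V` -/

/-- **(INVB₂).**  `a ∉ Λ`, any `e`, `B_d ≠ 0` of weight `12m`, `C₀ ≠ 0`, `F` holomorphic and equal to `C₀·B_d·(t_W∘φ)·V_{a,e}(c·E_f)` on the good set.
Then for `γ ∈ Γ₀(N)`: `V_{a,e}` periodic under `μ_γ = c·{∞,γ∞}_f` ⟹ `F ∣[12m] γ = F`, and conversely (`F ∣[12m] γ = ρ_γ•F` with `ρ_γ` the multiplier
of `V` along `μ_γ ∈ Λ`, and `F ≢ 0`). [folklore] [cite: WhittakerWatson1927, §20.421] -/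
theorem sqRootWitnessInvarianceB (D : ModularParametrizationData W N) [W.IsElliptic] [W.IsGloballyMinimal] {a : ℂ} (ha : a ∉ D.L.lattice)
    (e : ℂ) {m : ℕ} {Bd : ModularForm (Gamma0 N) (12 * (m : ℤ))} (hBd : Bd ≠ 0) {C₀ : ℂ} (hC₀ : C₀ ≠ 0)
    {F : ℍ → ℂ} (hFd : MDifferentiable 𝓘(ℂ) 𝓘(ℂ) F)
    (hF : ∀ τ : ℍ, (D.c : ℂ) * eichlerIntegral D.f τ ∉ D.L.lattice → minimalY D τ ≠ 0 →
      F τ = C₀ * Bd τ * (minimalParam D τ * sigmaSqRoot D.L a e ((D.c : ℂ) * eichlerIntegral D.f τ)))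
    (γ : Gamma0 N) :
    ((∀ w : ℂ, sigmaSqRoot D.L a e (w + (D.c : ℂ) * cuspSymbol D.f γ) = sigmaSqRoot D.L a e w) →
        F ∣[(12 * (m : ℤ))] (γ : SL(2, ℤ)) = F) ∧
      (F ∣[(12 * (m : ℤ))] (γ : SL(2, ℤ)) = F →
        ∀ w : ℂ, sigmaSqRoot D.L a e (w + (D.c : ℂ) * cuspSymbol D.f γ) = sigmaSqRoot D.L a e w) := by
  have hc0 : D.c ≠ 0 := D.maninConstant_ne_zero_holds
  have hf : D.f ≠ 0 := newform_ne_zero D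
  have hF' : ∀ τ : ℍ, (D.c : ℂ) * eichlerIntegral D.f τ ∉ D.L.lattice → minimalY D τ ≠ 0 →
      F τ = C₀ * Bd τ * kummerMinBlock D a (3 * e / 2) τ := fun τ hw hY ↦ by
    rw [hF τ hw hY, minimalParam_mul_sigmaSqRoot_eq]
  -- the multiplier of `V_{a,e} = W_{a,3e/2}` along `μ_γ`
  obtain ⟨ρ, -, hρ⟩ := sigmaSqRoot_add_of_mem_lattice D.L a e (smul_cuspSymbol_mem_lattice D γ)
  have hρ' : ∀ w : ℂ, sigmaCubeRoot D.L a (3 * e / 2) (w + (D.c : ℂ) * cuspSymbol D.f γ) = ρ * sigmaCubeRoot D.L a (3 * e / 2) w :=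
    fun w ↦ by rw [← sigmaSqRoot_eq_sigmaCubeRoot, ← sigmaSqRoot_eq_sigmaCubeRoot, hρ w]
  constructor
  · intro hper
    have h := slashB_eq_smul D hc0 hf a (3 * e / 2) Bd C₀ hFd hF' γ (ρ := 1) fun w ↦ by
      rw [← sigmaSqRoot_eq_sigmaCubeRoot, ← sigmaSqRoot_eq_sigmaCubeRoot, hper w, one_mul]
    rw [h, one_smul]
  · intro hinv w
    have hρF := slashB_eq_smul D hc0 hf a (3 * e / 2) Bd C₀ hFd hF' γ hρ'
    obtain ⟨τ₁, hτ₁⟩ := exists_apply_ne_zero_B D hc0 hf ha (3 * e / 2) hBd hC₀ hF'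
    have hρ1 : ρ = 1 := by
      have h := congrFun hρF τ₁
      rw [hinv, Pi.smul_apply, smul_eq_mul] at h
      have h' : (ρ - 1) * F τ₁ = 0 := by linear_combination -h
      exact sub_eq_zero.mp ((mul_eq_zero.mp h').resolve_right hτ₁)
    rw [hρ w, hρ1, one_mul]

end Summit.BirchSwinnertonDyer.BirchSwinnertonDyer.Theorems.ManinLocalTwoThree.SqRootWitness

end
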